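import Summits.Parity.GeneralizedHardyLittlewood.Theses.HullDial

/-!
# Birth skeleton (BC3) for crux `HullPairsLevel` — stmt-Parity-13090
(route `HullDial`, route-Parity-HullDial, rank 2; sub-problem `GeneralizedHardyLittlewood`)

Planner `planner-skel-stmt-Parity-13090-0`, 2026-08-17 (skeleton-register, re-audit bin REPAIRABLE).
Published as `Cruxes/HullPairsLevel/Lines/birth.lean`.

The crux is ONE level of distribution `θ > 1/2` for pairs of power-residue hull numbers against the
tilted two-colour model `G_x`: `∃ θ ∈ (1/2,1) ∀ k ≥ 8 ∀ even h ∃ δ > 0`, eventually in `x`, uniformly in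
primes `ℓ ≤ (log x)^8` with `k ∣ ℓ−1`, `h < ℓ`:
`Σ_{d ∣ P(√x), d ≤ x^θ} |A_d(x) − G_x(d)·A_1(x)| ≤ A_1(x)·(log x)^(−2/k−δ)`.

THE LINE — the classical anatomy of a level-of-distribution theorem, cut by the RANGE of the modulus
(the route's own two-layer plan `HullPairsSW → HullPairsBV → HullPairsBeyondHalf → HullPairsLevel`):

* `stub_siegelWalfiszRange : SWRange` — POLYLOG MODULI ("Siegel–Walfisz for hull pairs"): for every
  `A > 0` the remainder over `d ∣ P(√x)`, `d ≤ (log x)^A` is `≤ A_1·(log x)^(−2/k−δ)` (δ may depend on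
  `A, k, h`). Individual equidistribution of hull PAIRS in progressions of polylogarithmic modulus to the
  relative precision `(log x)^(−2/k−δ−A)`; binary (it is a statement about `1_N(n)1_N(n+h)`), but only
  "level 0⁺". Size L. Why it might fail: a secondary term of relative size `≥ (log x)^(−2/k)` in `A_d/A_1`
  already at bounded `d` (the tilt `T_x` wrong to second order), or non-uniformity in `ℓ ≤ (log x)^8`.
* `stub_largeSieveStep : SWRange → BVRange` — THE LARGE-SIEVE STEP: from polylog moduli to EVERY level
  `θ₀ < 1/2` (`BVRange`: `∀ θ₀ ∈ (0,1/2)`, remainder over `d ≤ x^θ₀`). For primes this implication is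
  Bombieri's theorem (Gallagher–Bombieri large sieve + Vaughan's identity; tree
  `BombieriVinogradovStatement_holds`); for the pair indicator `1_N(n)1_N(n+h)` the bilinear structure has
  to come from the multiplicativity of `1_N` (type I/II sums `Σ a_m b_n 1_N(mn+h)` in progressions,
  Granville–Shao-type BV for multiplicative functions, arXiv:1703.06865) — open. Size L/XL.
* `stub_beyondHalf : BeyondHalf` — THE INCREMENT BEYOND THE SQUARE-ROOT BARRIER (load-bearing, hardest;
  this is where `Literature.Barriers.Parity.LargeSieveLevelHalf` bites): `∃ θ₀ ∈ (0,1/2) ∃ θ ∈ (1/2,1)`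
  with the remainder over the annulus `x^θ₀ < d ≤ x^θ` bounded by `A_1·(log x)^(−2/k−δ)`. Intended
  engine: dispersion (Linnik; Fouvry–Iwaniec, BombieriFriedlanderIwaniecActa1986, ZhangAnnals2014 /
  Polymath8a2014 for smooth moduli, Maynard2020LargeModuliII) fed by hull pairs averaged over dilations.
  Its natural next split is by the factorisation type of `d` (x^σ-smooth moduli: Zhang–Polymath shape;
  moduli with a prime factor `> x^σ`: open even for primes in absolute value). Size XL / open.

Composition (sorry-free, below): `HullPairsLevel_of : SWRange → (SWRange → BVRange) → BeyondHalf →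
HullPairsLevel` — take `θ₀, θ` from `BeyondHalf`, `BVRange` at `θ₀` by modus ponens, and for each
`k, h` the two `δ`'s; split `Σ_{d ≤ x^θ} = Σ_{d ≤ x^θ₀} + Σ_{x^θ₀ < d ≤ x^θ}` (nonnegative terms,
`sum_filter_le_add`) and absorb `(log x)^(−2/k−δ₁) + (log x)^(−2/k−δ₂) ≤ (log x)^(−2/k−min/2)` once
`(log x)^(min/2) ≥ 2` (`two_errors_le`). The abstract layer (`LevelWith`, `SWWith`, `BVWith`,
`BeyondWith`, `level_of_bv_beyond`) is stated over an arbitrary pair count `A` and model `G`; the stub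
statements `SWRange`, `BVRange`, `BeyondHalf` instantiate it with the crux's OWN `let`-spelling of
`res/hull/A/T/G` (copied verbatim from `Theses/HullDial.lean`), so that `HullPairsLevel_of` concludes the
route decl `Summit.Parity.GeneralizedHardyLittlewood.Theses.HullDial.HullPairsLevel` BY NAME by
definitional unfolding only. Conversely `stubs_of_HullPairsLevel : HullPairsLevel → SWRange ∧ BVRange ∧
BeyondHalf` (sorry-free): every stub is a CONSEQUENCE of the crux, so no stub overshoots it and a
refutation of any stub refutes the crux.

Hypotheses of `HullPairsLevel_of` are spelled `__Registered.stub_X` (`rfl`-aliases keyed by the stub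
names, the device of `AtomisticToContinuum/…/AmplitudeLDP/Lines/birth.lean`) for the native skeleton
audit. Sorries live ONLY in the three `stub_*` theorems.

Disproof used: none exists for this crux on 2026-08-17 (no `Cruxes/HullPairsLevel/` directory in the
tree before this file: no `Disproof.lean`, no landed `Theorems/HullPairsLevel/Negative/*`; `ledger crux ls`
shows no workfiles); negatives index of Parity (3 refuted statements on 2026-08-17: convolution-moment
level 1 of PrimeDeterminantCells, TupleElliott of InverseSieveTuples, rectangle-Chowla of
ShiftedMultiplicationTable) not touched — no stub mentions `Λ ⋆ Λ`, affine-linear tuples or a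
Chowla-type correlation; every stub is implied by the crux (`stubs_of_HullPairsLevel`). Degenerate audit: `d = 1` contributes `|A_1 − G_x(1)A_1| = 0`
(`G_x(1) = T_x(1)² = 1`); a non-split prime `p` has `G_x(p) = 0 = A_p`; so no stub is false at the
trivial moduli, and none is vacuous (`θ₀ < 1/2 < θ` keeps the annulus through `√x`; `SWRange`/`BVRange`
quantify over every `A > 0` / `θ₀ ∈ (0,1/2)`).

BC3 audit (planner folder `bc/`, 2026-08-17, farm `lean check --json`): this file rc 0, errors [],
sorries 3 = the three `stub_*` (the three `declaration uses sorry` warnings sit exactly on them),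
`#print axioms HullPairsLevel_of` = [propext, Classical.choice, Quot.sound] (no `sorryAx`);
`#h21_check_skeleton` preview: ok, codes [], theorem `HullPairsLevel_of`. Probes (files
`bc/<Stub>_probe.lean`: the stub definitions only, no lemma of this file): for every stub statement
`S ∈ {SWRange, SWRange → BVRange, BeyondHalf}` both `S → HullPairsLevel` and
`S → _root_.GeneralizedHardyLittlewood` by `first | exact? | simpa [S] | (unfold S; simpa) | aesop` under
`maxHeartbeats 400000` FAIL (rc 1; `exact?`, `simpa`, `unfold; simpa` close nothing, `aesop` ends
non-terminally on the untouched goal `⊢ HullPairsLevel` / `⊢ GeneralizedHardyLittlewood`, the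
`(SWRange → BVRange) → HullPairsLevel` probe exhausts the heartbeats) — 6/6 fail: no stub is cheaply the
crux or the summit. Vacuity probes (`bc/vacuity_probe.lean`): neither `S` nor `¬S` is closed by
`exact? | (unfold; simp) | (unfold; aesop) | positivity` for any of the three — 6/6 fail.
-/

namespace Summit.Parity.GeneralizedHardyLittlewood.Cruxes.HullPairsLevel.Birth

-- Same `open`s as the route file `Theses/HullDial.lean`, so that the verbatim `let`-spelling of the
-- crux's objects below elaborates to the identical terms (classical decidability of the filters).
open scoped BigOperators Topology Manifold Classical MeasureTheory ProbabilityTheory Matrix InnerProductSpace ComplexConjugate ContinuousMap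
open Filter Set Function TopologicalSpace MeasureTheory
open Summit.Parity.GeneralizedHardyLittlewood.Theses.HullDial

/-! ## Abstract statement shapes over a pair count `A ℓ k h x d` and a model density `G ℓ k h x d` -/

/-- The crux body with `A` (pair congruence count) and `G` (tilted model) abstracted: level `x^θ` for
one `θ ∈ (1/2, 1)`, all `k ≥ 8`, all even `h`. `LevelWith A G` with the crux's own `A, G` is
definitionally `HullPairsLevel`. [folklore] -/
def LevelWith (A G : ℕ → ℕ → ℕ → ℝ → ℕ → ℝ) : Prop :=
  ∃ θ : ℝ, 1 / 2 < θ ∧ θ < 1 ∧ ∀ k : ℕ, 8 ≤ k → ∀ h : ℕ, 1 ≤ h → Even h → ∃ δ : ℝ, 0 < δ ∧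
    ∀ᶠ x : ℝ in Filter.atTop, ∀ ℓ : ℕ, ℓ.Prime → (ℓ : ℝ) ≤ Real.log x ^ 8 → k ∣ ℓ - 1 → h < ℓ →
      ∑ d ∈ (primorial (⌈Real.sqrt x⌉₊ - 1)).divisors.filter (fun d : ℕ => (d : ℝ) ≤ x ^ θ),
        |A ℓ k h x d - G ℓ k h x d * A ℓ k h x 1| ≤ A ℓ k h x 1 * Real.log x ^ (-(2 / (k : ℝ)) - δ)

/-- Siegel–Walfisz range: the remainder over polylogarithmic moduli `d ≤ (log x)^A`, every `A > 0`.
[folklore] -/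
def SWWith (A G : ℕ → ℕ → ℕ → ℝ → ℕ → ℝ) : Prop :=
  ∀ a : ℝ, 0 < a → ∀ k : ℕ, 8 ≤ k → ∀ h : ℕ, 1 ≤ h → Even h → ∃ δ : ℝ, 0 < δ ∧
    ∀ᶠ x : ℝ in Filter.atTop, ∀ ℓ : ℕ, ℓ.Prime → (ℓ : ℝ) ≤ Real.log x ^ 8 → k ∣ ℓ - 1 → h < ℓ →
      ∑ d ∈ (primorial (⌈Real.sqrt x⌉₊ - 1)).divisors.filter
          (fun d : ℕ => (d : ℝ) ≤ Real.log x ^ a),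
        |A ℓ k h x d - G ℓ k h x d * A ℓ k h x 1| ≤ A ℓ k h x 1 * Real.log x ^ (-(2 / (k : ℝ)) - δ)

/-- Bombieri–Vinogradov range: the remainder over `d ≤ x^θ₀` for EVERY `θ₀ ∈ (0, 1/2)`. [folklore] -/
def BVWith (A G : ℕ → ℕ → ℕ → ℝ → ℕ → ℝ) : Prop :=
  ∀ θ₀ : ℝ, 0 < θ₀ → θ₀ < 1 / 2 → ∀ k : ℕ, 8 ≤ k → ∀ h : ℕ, 1 ≤ h → Even h → ∃ δ : ℝ, 0 < δ ∧
    ∀ᶠ x : ℝ in Filter.atTop, ∀ ℓ : ℕ, ℓ.Prime → (ℓ : ℝ) ≤ Real.log x ^ 8 → k ∣ ℓ - 1 → h < ℓ →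
      ∑ d ∈ (primorial (⌈Real.sqrt x⌉₊ - 1)).divisors.filter (fun d : ℕ => (d : ℝ) ≤ x ^ θ₀),
        |A ℓ k h x d - G ℓ k h x d * A ℓ k h x 1| ≤ A ℓ k h x 1 * Real.log x ^ (-(2 / (k : ℝ)) - δ)

/-- Beyond the square root: for SOME `θ₀ < 1/2 < θ < 1` the remainder over the annulus
`x^θ₀ < d ≤ x^θ`. [folklore] -/
def BeyondWith (A G : ℕ → ℕ → ℕ → ℝ → ℕ → ℝ) : Prop :=
  ∃ θ₀ : ℝ, 0 < θ₀ ∧ θ₀ < 1 / 2 ∧ ∃ θ : ℝ, 1 / 2 < θ ∧ θ < 1 ∧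
    ∀ k : ℕ, 8 ≤ k → ∀ h : ℕ, 1 ≤ h → Even h → ∃ δ : ℝ, 0 < δ ∧
    ∀ᶠ x : ℝ in Filter.atTop, ∀ ℓ : ℕ, ℓ.Prime → (ℓ : ℝ) ≤ Real.log x ^ 8 → k ∣ ℓ - 1 → h < ℓ →
      ∑ d ∈ (primorial (⌈Real.sqrt x⌉₊ - 1)).divisors.filter
          (fun d : ℕ => x ^ θ₀ < (d : ℝ) ∧ (d : ℝ) ≤ x ^ θ),
        |A ℓ k h x d - G ℓ k h x d * A ℓ k h x 1| ≤ A ℓ k h x 1 * Real.log x ^ (-(2 / (k : ℝ)) - δ)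

/-! ## The three stub statements, in the crux's own spelling

The `let`-header below is copied verbatim from `HullPairsLevel` in `Theses/HullDial.lean`
(`res` = non-zero `k`-th power residue mod `ℓ`, `hull` = all prime factors are residues, `A` = pair
congruence count, `T` = tilt, `G` = tilted two-colour model). -/

/-- **SWRange** — Siegel–Walfisz range for hull pairs: for every `A > 0`, `k ≥ 8`, even `h` there is
`δ > 0` with, for all large `x` and every prime `ℓ ≤ (log x)^8`, `k ∣ ℓ−1`, `ℓ > h`:
`Σ_{d ∣ P(√x), d ≤ (log x)^A} |A_d(x) − G_x(d) A_1(x)| ≤ A_1(x)·(log x)^(−2/k−δ)`. [folklore] -/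
def SWRange : Prop :=
  let res : ℕ → ℕ → ℕ → Prop := fun ℓ k u => ∃ v : ZMod ℓ, v ≠ 0 ∧ v ^ k = (u : ZMod ℓ); let hull : ℕ → ℕ → ℕ → Prop := fun ℓ k n => ∀ p ∈ n.primeFactors, res ℓ k p; let A : ℕ → ℕ → ℕ → ℝ → ℕ → ℝ := fun ℓ k h x d => (((Finset.Icc 1 ⌊x⌋₊).filter (fun n => d ∣ n * (n + h) ∧ hull ℓ k n ∧ hull ℓ k (n + h))).card : ℝ); let T : ℕ → ℝ → ℕ → ℝ := fun k x e => (1 - Real.log (e : ℝ) / Real.log x) ^ (-(1 - 1 / (k : ℝ))); let G : ℕ → ℕ → ℕ → ℝ → ℕ → ℝ := fun ℓ k h x d => if Squarefree d ∧ (∀ p ∈ d.primeFactors, res ℓ k p) then (1 / (d : ℝ)) * ∑ e ∈ (d / Nat.gcd d h).divisors, T k x (Nat.gcd d h * e) * T k x (Nat.gcd d h * (d / Nat.gcd d h / e)) else 0; SWWith A G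

/-- **BVRange** — Bombieri–Vinogradov range for hull pairs: for every `θ₀ ∈ (0, 1/2)`, `k ≥ 8`, even
`h` there is `δ > 0` with, for all large `x` and every prime `ℓ ≤ (log x)^8`, `k ∣ ℓ−1`, `ℓ > h`:
`Σ_{d ∣ P(√x), d ≤ x^θ₀} |A_d(x) − G_x(d) A_1(x)| ≤ A_1(x)·(log x)^(−2/k−δ)`. [folklore] -/
def BVRange : Prop :=
  let res : ℕ → ℕ → ℕ → Prop := fun ℓ k u => ∃ v : ZMod ℓ, v ≠ 0 ∧ v ^ k = (u : ZMod ℓ); let hull : ℕ → ℕ → ℕ → Prop := fun ℓ k n => ∀ p ∈ n.primeFactors, res ℓ k p; let A : ℕ → ℕ → ℕ → ℝ → ℕ → ℝ := fun ℓ k h x d => (((Finset.Icc 1 ⌊x⌋₊).filter (fun n => d ∣ n * (n + h) ∧ hull ℓ k n ∧ hull ℓ k (n + h))).card : ℝ); let T : ℕ → ℝ → ℕ → ℝ := fun k x e => (1 - Real.log (e : ℝ) / Real.log x) ^ (-(1 - 1 / (k : ℝ))); let G : ℕ → ℕ → ℕ → ℝ → ℕ → ℝ := fun ℓ k h x d =>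 if Squarefree d ∧ (∀ p ∈ d.primeFactors, res ℓ k p) then (1 / (d : ℝ)) * ∑ e ∈ (d / Nat.gcd d h).divisors, T k x (Nat.gcd d h * e) * T k x (Nat.gcd d h * (d / Nat.gcd d h / e)) else 0; BVWith A G

/-- **BeyondHalf** — the increment beyond the square-root barrier: there are `θ₀ ∈ (0, 1/2)` and
`θ ∈ (1/2, 1)` such that for every `k ≥ 8`, even `h` there is `δ > 0` with, for all large `x` and
every prime `ℓ ≤ (log x)^8`, `k ∣ ℓ−1`, `ℓ > h`:
`Σ_{d ∣ P(√x), x^θ₀ < d ≤ x^θ} |A_d(x) − G_x(d) A_1(x)| ≤ A_1(x)·(log x)^(−2/k−δ)`. [folklore] -/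
def BeyondHalf : Prop :=
  let res : ℕ → ℕ → ℕ → Prop := fun ℓ k u => ∃ v : ZMod ℓ, v ≠ 0 ∧ v ^ k = (u : ZMod ℓ); let hull : ℕ → ℕ → ℕ → Prop := fun ℓ k n => ∀ p ∈ n.primeFactors, res ℓ k p; let A : ℕ → ℕ → ℕ → ℝ → ℕ → ℝ := fun ℓ k h x d => (((Finset.Icc 1 ⌊x⌋₊).filter (fun n => d ∣ n * (n + h) ∧ hull ℓ k n ∧ hull ℓ k (n + h))).card : ℝ); let T : ℕ → ℝ → ℕ → ℝ := fun k x e => (1 - Real.log (e : ℝ) / Real.log x) ^ (-(1 - 1 / (k : ℝ))); let G : ℕ → ℕ → ℕ → ℝ → ℕ → ℝ := fun ℓ k h x d => if Squarefree d ∧ (∀ p ∈ d.primeFactors, res ℓ k p) then (1 / (d : ℝ)) * ∑ e ∈ (d / Nat.gcd d h).divisors, T k x (Nat.gcd d h * e) * T k x (Nat.gcd d h * (d / Nat.gcd d h / e)) else 0; BeyondWith A G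

/-! ## Registered stubs (the ONLY `sorry`s of this file) -/

/-- stub 1: Siegel–Walfisz range for hull pairs (polylog moduli). -/
theorem stub_siegelWalfiszRange : SWRange := by
  sorry

/-- stub 2: the large-sieve step, polylog moduli ⟹ every level `θ₀ < 1/2`. -/
theorem stub_largeSieveStep : SWRange → BVRange := by
  sorry

/-- stub 3: the increment `(x^θ₀, x^θ]` across `√x` (hardest stub; the barrier-carrying one). -/
theorem stub_beyondHalf : BeyondHalf := by
  sorry

/-! ## Name-keyed aliases of the stub statements — the hypotheses of `HullPairsLevel_of`

The native skeleton audit (`#h21_check_skeleton`) admits a hypothesis of the skeleton theorem only if its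
head constant is a registered obligation or is NAMED like a declared stub; `__Registered.stub_X` is the
statement of `stub_X` under that name. Each alias is `rfl`-equal to its statement. -/
namespace __Registered

/-- Alias of `SWRange` keyed by the registered stub name. -/
abbrev stub_siegelWalfiszRange : Prop := SWRange
/-- Alias of `SWRange → BVRange` keyed by the registered stub name. -/
abbrev stub_largeSieveStep : Prop := SWRange → BVRange
/-- Alias of `BeyondHalf` keyed by the registered stub name. -/
abbrev stub_beyondHalf : Prop := BeyondHalf

end __Registered

/-! ## Sorry-free infrastructure -/

/-- Splitting a filtered sum of nonnegative reals along a case distinction: if `P ∧ ¬Q ⇒ R` on `S`,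
then `Σ_{S|P} f ≤ Σ_{S|Q} f + Σ_{S|R} f`. (Decidability binders are implicit so that they are taken from
the goal, not re-synthesised.) [folklore] -/
theorem sum_filter_le_add {ι : Type*} (S : Finset ι) (f : ι → ℝ) (hf : ∀ i, 0 ≤ f i)
    (P Q R : ι → Prop) {_ : DecidablePred P} {_ : DecidablePred Q} {_ : DecidablePred R}
    (hPQR : ∀ i ∈ S, P i → ¬ Q i → R i) :
    ∑ i ∈ S.filter P, f i ≤ ∑ i ∈ S.filter Q, f i + ∑ i ∈ S.filter R, f i := by
  rw [← Finset.sum_filter_add_sum_filter_not (S.filter P) Q f]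
  apply add_le_add
  · apply Finset.sum_le_sum_of_subset_of_nonneg
    · intro i hi
      simp only [Finset.mem_filter] at hi ⊢
      exact ⟨hi.1.1, hi.2⟩
    · intro i _ _
      exact hf i
  · apply Finset.sum_le_sum_of_subset_of_nonneg
    · intro i hi
      simp only [Finset.mem_filter] at hi ⊢
      exact ⟨hi.1.1, hPQR i hi.1.1 hi.1.2 hi.2⟩
    · intro i _ _
      exact hf i

/-- A filtered sum of nonnegative reals is monotone in the predicate. [folklore] -/
theorem sum_filter_le_of_imp {ι : Type*} (S : Finset ι) (f : ι → ℝ) (hf : ∀ i, 0 ≤ f i)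
    (P Q : ι → Prop) {_ : DecidablePred P} {_ : DecidablePred Q}
    (hPQ : ∀ i ∈ S, P i → Q i) :
    ∑ i ∈ S.filter P, f i ≤ ∑ i ∈ S.filter Q, f i := by
  apply Finset.sum_le_sum_of_subset_of_nonneg
  · intro i hi
    simp only [Finset.mem_filter] at hi ⊢
    exact ⟨hi.1, hPQ i hi.1 hi.2⟩
  · intro i _ _
    exact hf i

/-- Two error terms `X·L^(−c−δ₁)`, `X·L^(−c−δ₂)` add up to at most `X·L^(−c−min(δ₁,δ₂)/2)` as soon as
`L ≥ 1` and `L^(min/2) ≥ 2`. [folklore] -/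
theorem two_errors_le {L X c δ₁ δ₂ B₁ B₂ : ℝ} (hL : 1 ≤ L) (hX : 0 ≤ X)
    (h2 : 2 ≤ L ^ (min δ₁ δ₂ / 2))
    (hB₁ : B₁ ≤ X * L ^ (-c - δ₁)) (hB₂ : B₂ ≤ X * L ^ (-c - δ₂)) :
    B₁ + B₂ ≤ X * L ^ (-c - min δ₁ δ₂ / 2) := by
  have hL0 : 0 < L := lt_of_lt_of_le one_pos hL
  set m := min δ₁ δ₂ with hm
  have hm₁ : m ≤ δ₁ := min_le_left δ₁ δ₂
  have hm₂ : m ≤ δ₂ := min_le_right δ₁ δ₂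
  have e₁ : L ^ (-c - δ₁) ≤ L ^ (-c - m) :=
    Real.rpow_le_rpow_of_exponent_le hL (by linarith)
  have e₂ : L ^ (-c - δ₂) ≤ L ^ (-c - m) :=
    Real.rpow_le_rpow_of_exponent_le hL (by linarith)
  have hpos : 0 ≤ L ^ (-c - m) := Real.rpow_nonneg hL0.le _
  have key : X * L ^ (-c - m / 2) = X * L ^ (-c - m) * L ^ (m / 2) := by
    rw [show -c - m / 2 = (-c - m) + m / 2 by ring, Real.rpow_add hL0]
    ring
  calc B₁ + B₂ ≤ X * L ^ (-c - m) + X * L ^ (-c - m) :=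
        add_le_add (hB₁.trans (mul_le_mul_of_nonneg_left e₁ hX))
          (hB₂.trans (mul_le_mul_of_nonneg_left e₂ hX))
    _ = X * L ^ (-c - m) * 2 := by ring
    _ ≤ X * L ^ (-c - m) * L ^ (m / 2) := mul_le_mul_of_nonneg_left h2 (mul_nonneg hX hpos)
    _ = X * L ^ (-c - m / 2) := key.symm

/-- **The composition at the abstract level.** Bombieri–Vinogradov range + the increment beyond `√x`
give the full level `θ`: `θ₀, θ` from the increment, `δ := min(δ_BV, δ_beyond)/2`, and eventually in
`x` the sum over `d ≤ x^θ` splits as `(d ≤ x^θ₀) + (x^θ₀ < d ≤ x^θ)`. [folklore] -/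
theorem level_of_bv_beyond (A G : ℕ → ℕ → ℕ → ℝ → ℕ → ℝ) (hA : ∀ ℓ k h x d, 0 ≤ A ℓ k h x d)
    (hBV : BVWith A G) (hB : BeyondWith A G) : LevelWith A G := by
  obtain ⟨θ₀, hθ₀, hθ₀', θ, hθ, hθ', hmain⟩ := hB
  refine ⟨θ, hθ, hθ', fun k hk h hh hhe => ?_⟩
  obtain ⟨δ₁, hδ₁, ev₁⟩ := hBV θ₀ hθ₀ hθ₀' k hk h hh hhe
  obtain ⟨δ₂, hδ₂, ev₂⟩ := hmain k hk h hh hhe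
  have hm : 0 < min δ₁ δ₂ := lt_min hδ₁ hδ₂
  refine ⟨min δ₁ δ₂ / 2, half_pos hm, ?_⟩
  have evlog2 : ∀ᶠ x : ℝ in Filter.atTop, (2 : ℝ) ≤ Real.log x ^ (min δ₁ δ₂ / 2) :=
    ((tendsto_rpow_atTop (half_pos hm)).comp Real.tendsto_log_atTop).eventually_ge_atTop 2
  have evlog1 : ∀ᶠ x : ℝ in Filter.atTop, (1 : ℝ) ≤ Real.log x :=
    Real.tendsto_log_atTop.eventually_ge_atTop 1
  filter_upwards [ev₁, ev₂, evlog2, evlog1] with x hx₁ hx₂ hlog2 hlog1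
  intro ℓ hℓ hℓ' hkℓ hhℓ
  have b₁ := hx₁ ℓ hℓ hℓ' hkℓ hhℓ
  have b₂ := hx₂ ℓ hℓ hℓ' hkℓ hhℓ
  have step1 :
      ∑ d ∈ (primorial (⌈Real.sqrt x⌉₊ - 1)).divisors.filter (fun d : ℕ => (d : ℝ) ≤ x ^ θ),
          |A ℓ k h x d - G ℓ k h x d * A ℓ k h x 1|
        ≤ ∑ d ∈ (primorial (⌈Real.sqrt x⌉₊ - 1)).divisors.filter (fun d : ℕ => (d : ℝ) ≤ x ^ θ₀),
            |A ℓ k h x d - G ℓ k h x d * A ℓ k h x 1|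
          + ∑ d ∈ (primorial (⌈Real.sqrt x⌉₊ - 1)).divisors.filter
              (fun d : ℕ => x ^ θ₀ < (d : ℝ) ∧ (d : ℝ) ≤ x ^ θ),
            |A ℓ k h x d - G ℓ k h x d * A ℓ k h x 1| :=
    sum_filter_le_add _ _ (fun d => abs_nonneg _) _ _ _ (fun d _ hP hQ => ⟨not_le.mp hQ, hP⟩)
  exact step1.trans (two_errors_le hlog1 (hA ℓ k h x 1) hlog2 b₁ b₂)

/-! ## Composition: the crux BY NAME from the three stub statements (no `sorry` below) -/

/-- **HullPairsLevel_of** — Siegel–Walfisz range (stub 1) ⟹ Bombieri–Vinogradov range via the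
large-sieve step (stub 2, modus ponens) and, with the increment beyond `√x` (stub 3), the full level
`θ > 1/2` by `level_of_bv_beyond` (range splitting + `δ`-bookkeeping). Hypotheses = the three stub
statements under their registered names (`__Registered.stub_X` is the statement by `rfl`); conclusion
= the route decl, by name; the identification `LevelWith A G = HullPairsLevel` for the crux's own
`A, G` is by definitional unfolding of the verbatim `let`-spelling. [folklore] -/
theorem HullPairsLevel_of (hSW : __Registered.stub_siegelWalfiszRange)
    (hLS : __Registered.stub_largeSieveStep) (hB : __Registered.stub_beyondHalf) :
    Summit.Parity.GeneralizedHardyLittlewood.Theses.HullDial.HullPairsLevel := by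
  have hBV : BVRange := hLS hSW
  refine level_of_bv_beyond _ _ ?_ hBV hB
  intro ℓ k h x d
  exact Nat.cast_nonneg _

/-- Wiring check (an `example`, so that `HullPairsLevel_of` stays the only theorem concluding the
crux): the registered stubs feed the skeleton theorem as stated — this term becomes the crux proof when
the three `sorry`s above are discharged. -/
example : Summit.Parity.GeneralizedHardyLittlewood.Theses.HullDial.HullPairsLevel :=
  HullPairsLevel_of stub_siegelWalfiszRange stub_largeSieveStep stub_beyondHalf

/-- The plain-arrow form `<stub sigs> → HullPairsLevel` of the skeleton theorem (same proof term). -/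
example : SWRange → (SWRange → BVRange) → BeyondHalf →
    Summit.Parity.GeneralizedHardyLittlewood.Theses.HullDial.HullPairsLevel :=
  HullPairsLevel_of

/-! ## Exactness: every stub is a consequence of the crux (no stub overshoots) -/

/-- From the full level `θ` down to each range: the three pieces are sub-sums of the crux's sum, for
the Siegel–Walfisz range because `(log x)^a ≤ x^θ` eventually. [folklore] -/
theorem pieces_of_level (A G : ℕ → ℕ → ℕ → ℝ → ℕ → ℝ)
    (hLv : LevelWith A G) : SWWith A G ∧ BVWith A G ∧ BeyondWith A G := by
  obtain ⟨θ, hθ, hθ', hmain⟩ := hLv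
  have hθ0 : 0 < θ := by linarith
  refine ⟨?_, ?_, ?_⟩
  · -- Siegel–Walfisz range: d ≤ (log x)^a ≤ x^θ eventually
    intro a ha k hk h hh hhe
    obtain ⟨δ, hδ, ev⟩ := hmain k hk h hh hhe
    refine ⟨δ, hδ, ?_⟩
    have evcmp : ∀ᶠ x : ℝ in Filter.atTop, Real.log x ^ a ≤ x ^ θ := by
      have hlo := (isLittleO_log_rpow_rpow_atTop a hθ0).eventuallyLE
      filter_upwards [hlo, Filter.eventually_ge_atTop (1 : ℝ)] with x hx hx1
      have h1 : 0 ≤ Real.log x ^ a := Real.rpow_nonneg (Real.log_nonneg hx1) a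
      have h2 : 0 ≤ x ^ θ := Real.rpow_nonneg (by linarith) θ
      rw [Real.norm_of_nonneg h1, Real.norm_of_nonneg h2] at hx
      exact hx
    filter_upwards [ev, evcmp] with x hx hcmp
    intro ℓ hℓ hℓ' hkℓ hhℓ
    refine le_trans ?_ (hx ℓ hℓ hℓ' hkℓ hhℓ)
    exact sum_filter_le_of_imp _ _ (fun d => abs_nonneg _) _ _ (fun d _ hd => hd.trans hcmp)
  · -- Bombieri–Vinogradov range: x^θ₀ ≤ x^θ for x ≥ 1
    intro θ₀ hθ₀ hθ₀' k hk h hh hhe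
    obtain ⟨δ, hδ, ev⟩ := hmain k hk h hh hhe
    refine ⟨δ, hδ, ?_⟩
    filter_upwards [ev, Filter.eventually_ge_atTop (1 : ℝ)] with x hx hx1
    intro ℓ hℓ hℓ' hkℓ hhℓ
    refine le_trans ?_ (hx ℓ hℓ hℓ' hkℓ hhℓ)
    have hcmp : x ^ θ₀ ≤ x ^ θ := Real.rpow_le_rpow_of_exponent_le hx1 (by linarith)
    exact sum_filter_le_of_imp _ _ (fun d => abs_nonneg _) _ _ (fun d _ hd => hd.trans hcmp)
  · -- the annulus (x^{1/4}, x^θ] is part of the range d ≤ x^θ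
    refine ⟨1 / 4, by norm_num, by norm_num, θ, hθ, hθ', fun k hk h hh hhe => ?_⟩
    obtain ⟨δ, hδ, ev⟩ := hmain k hk h hh hhe
    refine ⟨δ, hδ, ?_⟩
    filter_upwards [ev] with x hx
    intro ℓ hℓ hℓ' hkℓ hhℓ
    refine le_trans ?_ (hx ℓ hℓ hℓ' hkℓ hhℓ)
    exact sum_filter_le_of_imp _ _ (fun d => abs_nonneg _) _ _ (fun d _ hd => hd.2)

/-- Every stub follows from the crux: `HullPairsLevel → SWRange ∧ BVRange ∧ BeyondHalf` (so together
with `HullPairsLevel_of` the reduction is exact: `HullPairsLevel ↔ SWRange ∧ BVRange ∧ BeyondHalf`, and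
`stub_largeSieveStep` is implied by `BVRange`). [folklore] -/
theorem stubs_of_HullPairsLevel
    (hLv : Summit.Parity.GeneralizedHardyLittlewood.Theses.HullDial.HullPairsLevel) :
    SWRange ∧ BVRange ∧ BeyondHalf :=
  pieces_of_level _ _ hLv

/-- The reduction is exact. [folklore] -/
theorem HullPairsLevel_iff_stubs :
    Summit.Parity.GeneralizedHardyLittlewood.Theses.HullDial.HullPairsLevel ↔
      SWRange ∧ BVRange ∧ BeyondHalf :=
  ⟨stubs_of_HullPairsLevel, fun h => HullPairsLevel_of h.1 (fun _ => h.2.1) h.2.2⟩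

end Summit.Parity.GeneralizedHardyLittlewood.Cruxes.HullPairsLevel.Birth
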